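import Summits.QuantumFields.BalabanUV.T4Continuum.Spine.NE5.TwoRunTorusWalkH226
import Summits.QuantumFields.BalabanUV.T4Continuum.Spine.NE5.TwoRunTorusWalkRePos

/-!
# Spine/NE5/TwoRunTorusWalkH226Symm — (2.26) for one term from ONE walk record + SYMMETRY: positivity, the spectral
# letter and the Γ₀-form letter read from the record (T31 ∘ T28) (cell `pub-balaban-gaps`, seat `ne5` gen 9)

WHY.  T31 `TwoRunTorusWalkH226.h226_of_termWalkData` gives (2.26) for one term from one walk record at a fixed
configuration, still taking NODE A's positivity `hA`, the spectral letter (`hc`, `hc0`) and the Γ₀-form letter (`hΓq`,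
`hg`) as inputs; T28 `TwoRunTorusWalkRePos` derives all of them from the same record given SYMMETRY of the precision.
THIS FILE is the composition: `h226_of_termWalkData_symm` — the only new binders are the envelopes
`hcE : K̄_C·m·(1+2∕w.κ)^ν ≤ c_E`, `hgE : c_E·(K̄_Γ·m·(1+2∕w.κ)^ν)² ≤ g` and NODE A's smallness
`hsmallRe : θ_E(w,α)·(m·(1+2∕w.κ)^ν)·c_E < 1`.  So Lemma 3's per-term input (2.26) needs from outside the record exactly:
σ-holomorphy of the kernels at `u` (free for local families, T27; (x12) for walk series), SYMMETRY of `A(σ,u)`, the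
potentials with (2.20), the common `χ` with (2.22), the column fibre bound (x10), rates and numerics.  Independent of the
(2.14)∕Cauchy holomorphy layer (no T21).

HONEST FRAMING.  Pure composition of T31 and T28 (both compositions of LANDED shapes); every record, region, function and
number is a HYPOTHESIS; nothing of Bałaban's constructed or asserted; NE5 NOT PRINTED ∕ NOT PROVED; leaves 0∕12; (D4)
0∕1; spine 0∕9.  Rung (B)+1 on a FIXED finite T⁴ — NOT continuum, NOT infinite volume, NOT mass gap, NOT Clay.
0 sorry, 0 `def`.

Sources: [II] = T. Bałaban, CMP **116** (1988) [Balaban1988RG2Cluster] p. 13, p. 15, (2.14)–(2.16) pp. 15–16, (2.20)–(2.26)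
pp. 16–17; [B9] = CMP **99** (1985) [Balaban1985BackgroundPropagators] Thm 3.10 p. 416.
-/

noncomputable section

namespace Summit.QuantumFields.BalabanUV.T4Continuum.Spine.NE5.TwoRunTorusWalkH226Symm

open Matrix Metric Set Finset
open Literature.MathematicalPhysics.QuantumFieldTheory.Balaban1983to89
open Literature.MathematicalPhysics.QuantumFieldTheory.Balaban1983to89.TreeLengthTorus (TPt TDom tsys)
open Literature.MathematicalPhysics.QuantumFieldTheory.Balaban1983to89.TreeLengthTorusTransfer (tclosure)
open Literature.MathematicalPhysics.QuantumFieldTheory.Balaban1983to89.B13Lemma3TorusData (TBond)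
open Literature.MathematicalPhysics.QuantumFieldTheory.Balaban1983to89.B13Lemma3TorusTerms (weight Z0)
open Literature.MathematicalPhysics.QuantumFieldTheory.Balaban1983to89.B13Term214 (core214 F214 term214)
open Literature.MathematicalPhysics.QuantumFieldTheory.Balaban1983to89.B13Bound143 (invTau)
open Literature.MathematicalPhysics.QuantumFieldTheory.Balaban1983to89.B5TorusCover (UT)
open Literature.MathematicalPhysics.QuantumFieldTheory.Balaban1983to89.B9Thm37GlueTorus (tdist1)
open Literature.MathematicalPhysics.QuantumFieldTheory.Balaban1983to89.B13PrimitiveKernels216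
  (Localisation17a Differences216 localisation17a_mono_rate)
open Literature.MathematicalPhysics.QuantumFieldTheory.Balaban1983to89.B13TermWalkData
  (WalkConsts TermKernels TermWalkData localisation17a_of_termWalkData differences216_of_termWalkData)
open Literature.MathematicalPhysics.QuantumFieldTheory.Balaban1983to89.B13TermWalkDataOneTorus (SmallTheta)
open Summit.QuantumFields.BalabanUV.T4Continuum.Spine.NE5.TwoRunTorusWalkH226 (h226_of_termWalkData)
open Summit.QuantumFields.BalabanUV.T4Continuum.Spine.NE5.TwoRunTorusWalkRePos
  (re_posDef_of_termWalkData eigenvalues_le_of_termWalkData gammaForm_le_of_termWalkData)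

variable {d L N' : ℕ} [NeZero L] [NeZero N'] {M : ℕ}
variable {ν : ℕ} {Nf : Fin ν → ℕ} [∀ i, NeZero (Nf i)]
variable {B : Type*} [NormedAddCommGroup B] [NormedSpace ℂ B]

open Classical in
/-- **(2.26) FOR ONE TERM FROM ONE WALK RECORD AND SYMMETRY** (T31 with `hA`, `hc`∕`hc0`, `hΓq`∕`hg` read from the
record by T28): data as in T31 `h226_of_termWalkData` minus those five binders, plus the envelopes `hcE`, `hgE` and NODE
A's smallness `hsmallRe` in the record's letters.  Conclusion: (2.26) for the (2.14)-term built from the record's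
kernels at the configuration `u`. [cite: Balaban1988RG2Cluster, p.13, p.15, (2.16) p.16, (2.24)–(2.26) p.17; Balaban1985BackgroundPropagators, Thm 3.10 p.416] -/
theorem h226_of_termWalkData_symm (c : B13.Consts) (hκ₁ : 1 ≤ c.κ₁) (hα₆ : c.α₆ ≠ 0)
    (Z : TDom d N') (t : Finset (TDom d (L * N')) × Finset (TBond d M (L * N')))
    (hpos : ∀ Y : TDom d (L * N'), 0 < invTau c ((tsys d (L * N')).dj Y))
    (hhalf : ∀ Y : TDom d (L * N'), invTau c ((tsys d (L * N')).dj Y) ≤ 1 / 2)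
    {Uτ : TDom d (L * N') → Set ℂ} (hUτ : ∀ Y, IsOpen (Uτ Y))
    (hUtau : ∀ Y : TDom d (L * N'), closedBall (0 : ℂ) ((invTau c ((tsys d (L * N')).dj Y))⁻¹) ⊆ Uτ Y)
    {r : ℝ} (hr : 0 < r) (hr' : r ≤ Real.exp c.κ₁ - 1)
    (hsubτ : ∀ Y, ∀ s ∈ Set.uIcc (0 : ℝ) 1, closedBall (s : ℂ) r ⊆ Uτ Y)
    (lZ : List (TPt d N')) (hlZ : lZ.Nodup ∧ lZ.toFinset = Z.1 \ tclosure L N' (Z0 M t))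
    (lD : List (TDom d (L * N'))) (hlD : lD.Nodup ∧ lD.toFinset = t.1)
    -- THE WALK RECORD OF THE TERM AT `c⁺` OVER THE PARAMETER SPACE (the (D4) walk road's objects, g1-p2's record)
    (𝒦 : TermKernels ({ c with κ₁ := c.κ₁ + 1 } : B13.Consts) d N' ν Nf B) [Fintype 𝒦.C₀] [DecidableEq 𝒦.C₀]
    {w : WalkConsts} {α Rσ₀ : ℝ} (hw : w.Admissible α Rσ₀) (hα : 0 ≤ α) (h𝒦 : TermWalkData 𝒦 w)
    {u : B} (hu : ‖u‖ ≤ α)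
    (Γ : (TPt d N' → ℂ) → (𝒦.Λ ⊕ 𝒦.C₀ → ℝ) → (𝒦.Λ → ℂ))
    (hlin : ∀ σ : TPt d N' → ℂ, (∀ j, σ j ∈ ball (0 : ℂ) (Real.exp (c.κ₁ + 1))) →
      ∀ X : 𝒦.Λ ⊕ 𝒦.C₀ → ℝ, Γ σ X = 𝒦.G2 σ u *ᵥ fun j => (X j : ℂ))
    (χY₀ χcP : (𝒦.Λ → ℝ) → ℝ) (hχ0 : ∀ Bf, 0 ≤ χY₀ Bf) (hχc0 : ∀ Bf, 0 ≤ χcP Bf) (Dfam : Finset (TDom d (L * N')))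
    (Vk : TDom d (L * N') → (𝒦.Λ → ℝ) → ℂ)
    -- what is NOT walk data: σ-holomorphy (NODE O), symmetry ∕ `Re ≻ 0` (NODE A), potentials (history channel)
    (hAhol : ∀ i j, DifferentiableOn ℂ (fun σ => 𝒦.A2 σ u i j) {σ | ∀ j, σ j ∈ ball (0 : ℂ) (Real.exp (c.κ₁ + 1))})
    (hGhol : ∀ i j, DifferentiableOn ℂ (fun σ => 𝒦.G2 σ u i j) {σ | ∀ j, σ j ∈ ball (0 : ℂ) (Real.exp (c.κ₁ + 1))})
    (hχm : Measurable χY₀) (hχcm : Measurable χcP) (hVm : ∀ Y, Measurable (Vk Y))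
    (hAs : ∀ σ : TPt d N' → ℂ, (∀ j, ‖σ j‖ ≤ Real.exp (c.κ₁ + 1)) → (𝒦.A2 σ u).IsSymm)
    -- the (2.22) shape, and (2.20) on the open PER-DOMAIN τ-region, uniform in `b`
    {γ₂ rP a₂₀ w₂₀ : ℝ} (qP : (𝒦.Λ → ℝ) → ℝ)
    (h222 : ∀ Bf, χY₀ Bf * χcP Bf ≤ Real.exp (-(γ₂ / 2 * rP ^ 2 * (t.2.card : ℕ)) + γ₂ / 2 * qP Bf))
    (hγ₂ : 0 ≤ γ₂) (hqP : ∀ Bf, qP Bf ≤ Bf ⬝ᵥ Bf) (ha0 : 0 ≤ a₂₀)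
    (h220U : ∀ τ : TDom d (L * N') → ℂ, (∀ Y, τ Y ∈ Uτ Y) →
      ∀ Bf, ∑ Y ∈ Dfam, ‖τ Y‖ * ‖Vk Y Bf‖ ≤ a₂₀ / 2 * (Bf ⬝ᵥ Bf) + w₂₀)
    -- a common fibre bound for row and column locations (`𝒦.hfib` bounds the rows by `𝒦.m`)
    {m : ℕ} (hm : 𝒦.m ≤ m) (hfibN : ∀ x : UT Nf, (Finset.univ.filter fun j => 𝒦.locN j = x).card ≤ m)
    -- rates: the record's torus rate `w.κ`, two drops for `Differences216`, two more for the (2.26) chain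
    {κa κb kap' kap'' θ : ℝ} (hκa : κa < w.kap) (hκb : κb < κa) (h2 : kap' < κb) (h1 : kap'' < kap')
    (hkap'' : 0 < kap'')
    -- NODE A's smallness BY NAME: `θ_Γ, θ_E ≤ θ` with `θ_• = 2K̄_•(e^{−εR_σ} + α∕R)` ((v)⁺ of `B13TermWalkDataOneTorus`)
    (hsm : SmallTheta w α θ)
    (hθR1le : (m * (1 + 2 / (κb - kap')) ^ ν) * (m * (1 + 2 / (kap' - kap'')) ^ ν)
      * ((2 * w.KbarΓ * Real.exp (-(w.ε * w.Rσ)) + 2 * w.KbarΓ * α / w.R) * w.KbarC * w.KbarΓ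
        + w.KbarΓ * (w.KbarC * (2 * w.KbarE * Real.exp (-(w.ε * w.Rσ)) + 2 * w.KbarE * α / w.R)
            * (𝒦.m * (1 + 2 / (w.kap - κa)) ^ ν) * w.KbarC * (𝒦.m * (1 + 2 / (κa - κb)) ^ ν)) * w.KbarΓ
        + w.KbarΓ * w.KbarC * (2 * w.KbarΓ * Real.exp (-(w.ε * w.Rσ)) + 2 * w.KbarΓ * α / w.R)) ≤ θ)
    (hsmallKθ : w.KbarC * (m * (1 + 2 / κb) ^ ν) * (θ * (m * (1 + 2 / kap'') ^ ν)) < 1)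
    {cE g : ℝ} (hcE : w.KbarC * (m * (1 + 2 / w.kap) ^ ν) ≤ cE)
    (hgE : cE * (w.KbarΓ * (m * (1 + 2 / w.kap) ^ ν)) ^ 2 ≤ g)
    (hsmallRe : (2 * w.KbarE * Real.exp (-(w.ε * w.Rσ)) + 2 * w.KbarE * α / w.R)
      * (m * (1 + 2 / w.kap) ^ ν) * cE < 1)
    (hαc : (2 * (θ * (m * (1 + 2 / kap'') ^ ν)) + (γ₂ + a₂₀)) * cE ≤ 1 / 2)
    (hsmall : (2 * (θ * (m * (1 + 2 / kap'') ^ ν)) + (γ₂ + a₂₀)) * (1 + 2 * cE * g) ≤ 1 / 2)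
    {a a₅ : ℝ} (hPa : a ≤ γ₂ * rP ^ 2)
    (hvol : 2 * (w.KbarC * (m * (1 + 2 / κb) ^ ν) * (θ * (m * (1 + 2 / kap'') ^ ν))
              * (1 + (1 - w.KbarC * (m * (1 + 2 / κb) ^ ν) * (θ * (m * (1 + 2 / kap'') ^ ν)))⁻¹) / 2)
          * (Fintype.card 𝒦.Λ : ℝ)
        + w₂₀ + (2 * (θ * (m * (1 + 2 / kap'') ^ ν)) + (γ₂ + a₂₀)) * cE * (Fintype.card 𝒦.Λ : ℝ)
        + (2 * (θ * (m * (1 + 2 / kap'') ^ ν)) + (γ₂ + a₂₀)) * (1 + 2 * cE * g) * (Fintype.card (𝒦.Λ ⊕ 𝒦.C₀) : ℝ)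
        ≤ a₅ * ((Z.1).card : ℝ)) :
    ‖term214 r lZ lD (core214 (fun σ => 𝒦.A2 σ u) Γ (F214 t.2.card χY₀ χcP Dfam Vk)) 0 0‖ ≤
      weight L M c Z a t * Real.exp (a₅ * ((Z.1).card : ℝ)) := by
  -- the letters from the record (T28), at the configuration `u`
  have hKc0 : 0 ≤ (1 + 2 / w.kap) ^ ν := by have := hw.hkap; positivity
  have hθE0 : 0 ≤ 2 * w.KbarE * Real.exp (-(w.ε * w.Rσ)) + 2 * w.KbarE * α / w.R := by
    have := hw.hKbarE; have := hα.trans_lt hw.hαR; positivity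
  have hmKc : (𝒦.m : ℝ) * (1 + 2 / w.kap) ^ ν ≤ m * (1 + 2 / w.kap) ^ ν :=
    mul_le_mul_of_nonneg_right (by exact_mod_cast hm) hKc0
  have hc0 : 0 ≤ cE := le_trans (by have := hw.hKbarC; positivity) hcE
  have hg : 0 ≤ g := le_trans (by positivity) hgE
  have hc : ∀ k, 𝒦.hC.1.eigenvalues k ≤ cE := fun k =>
    ((eigenvalues_le_of_termWalkData hw hα h𝒦 k).trans (mul_le_mul_of_nonneg_left hmKc hw.hKbarC)).trans hcE
  have hsm' : (2 * w.KbarE * Real.exp (-(w.ε * w.Rσ)) + 2 * w.KbarE * α / w.R)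
      * (𝒦.m * (1 + 2 / w.kap) ^ ν) * cE < 1 :=
    (mul_le_mul_of_nonneg_right (mul_le_mul_of_nonneg_left hmKc hθE0) hc0).trans_lt hsmallRe
  have hA : ∀ σ : TPt d N' → ℂ, (∀ j, ‖σ j‖ ≤ Real.exp (c.κ₁ + 1)) → ((𝒦.A2 σ u).map Complex.re).PosDef :=
    fun σ hσ => re_posDef_of_termWalkData hw hα h𝒦 hu σ hσ (hAs σ hσ) hc hsm'
  have hΓq : ∀ X : 𝒦.Λ ⊕ 𝒦.C₀ → ℝ, (𝒦.Γ₀ *ᵥ X) ⬝ᵥ (𝒦.C *ᵥ (𝒦.Γ₀ *ᵥ X)) ≤ g * (X ⬝ᵥ X) := by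
    intro X
    have hXX : 0 ≤ X ⬝ᵥ X := by
      simp only [dotProduct]; exact Finset.sum_nonneg fun i _ => mul_self_nonneg _
    refine (gammaForm_le_of_termWalkData hw hα h𝒦 hm hfibN X).trans (mul_le_mul_of_nonneg_right ?_ hXX)
    refine le_trans ?_ hgE
    exact mul_le_mul_of_nonneg_right ((mul_le_mul_of_nonneg_left hmKc hw.hKbarC).trans hcE) (sq_nonneg _)
  exact h226_of_termWalkData c hκ₁ hα₆ Z t hpos hhalf hUτ hUtau hr hr' hsubτ lZ hlZ lD hlD 𝒦 hw hα h𝒦 hu Γ hlin χY₀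
    χcP hχ0 hχc0 Dfam Vk hAhol hGhol hχm hχcm hVm hAs hA qP h222 hγ₂ hqP ha0 h220U hm hfibN hκa hκb h2 h1 hkap'' hsm
    hθR1le hsmallKθ hc0 hc hαc hg hΓq hsmall hPa hvol

end Summit.QuantumFields.BalabanUV.T4Continuum.Spine.NE5.TwoRunTorusWalkH226Symm

end
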